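import Literature.AlgebraicGeometry.Frobenioids.PadicKummerGaloisChart
import HarnessLib

/-!
# Frobenioids II, Thm. 2.4 (i): the isomorphism of Definition 2.2 contexts induced by an equivalence `Ψ` of
# `p`-adic Frobenioids (row (α), file D4 — chart level)

Mochizuki, *The geometry of Frobenioids II*, Kyushu J. Math. **62** (2008) 401–460, §2, Theorem 2.4 pp. 19–20
[cite: MochizukiFrdII2008, Thm 2.4 (i) p.19]: "`Ψ : C₁ ⥲ C₂` an equivalence of categories [which … induces a
1-compatible equivalence `Ψ_Base : D₁ ⥲ D₂`, hence an outer isomorphism `Π₁ ⥲ Π₂` … over an outer isomorphism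
`G₁ ⥲ G₂`]. … for `i = 1, 2`, `Aᵢ ∈ Ob(Cᵢ)` … `Ψ(A₁) = A₂`. Then … `Ψ` … induces isomorphisms
`O^□(A₁)^{H₁} ⥲ O^□(A₂)^{H₂}`; `(H₁)_{A₁} ⥲ (H₂)_{A₂}`; …"; proof p. 20: "`Ψ` preserves '`O^⊳(−)`'" ([FrdI] Cor. 4.10,
4.11 (ii)(iii)).

Definitions file (seat abc-iut-L1-t7, gen 4; GAP row G-L1t7-α, piece D4, CHART LEVEL). From a fully faithful
functor `F : C₁ ⥤ C₂` between `pᵢ`-adic Frobenioids (the equivalence `Ψ`), objects `A₁`, `A₂ := F A₁` with Galois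
charts `cᵢ` (file D2), and the two printed inputs BY NAME —
(hO) "`Ψ` preserves `O^⊳(−)`": `f ∈ O^▷(A₁) ↔ F f ∈ O^▷(F A₁)` ([FrdI] Cor. 4.11 (ii)(iii), row L02), and
(isoG, houter, map_H) "the outer isomorphism `G₁ ⥲ G₂`" over which `Ψ_Base` lies, mapping `H₁` onto `H₂`
([FrdII] Thm. 2.4 setting; the anabelian step, [FrdII] Ex. 1.3 (i)) — together with the chart property
"`Ker(Aut_C(A) → Aut_E(A_E)) = O^×(A)`" (`hkerᵢ`; automatic for the base of §2, file D3b) — we CONSTRUCT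
abc-iut-L1-t7's `Def22Context.Iso (ofChart c₁ H₁ hH₁) (ofChart c₂ H₂ hH₂)`: `isoC := F` on `Aut`, `isoO := F` on
`O^▷`, `isoE :=` the induced `Gal(L₁/K₁) ⥲ Gal(L₂/K₂)` (`galEquiv`, well defined by Thm. 1.2 (ii)), `isoG`.
With files D1–D3b and `thm24i_ofChart`, this closes Theorem 2.4 (i) for `(A₁, Ψ A₁)` modulo `hfs` and these named
inputs. Nothing here concerns [IUTchIII]; classical.
-/

noncomputable section

namespace Literature.AlgebraicGeometry.Frobenioids

namespace PadicFrd

namespace Datum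

namespace GaloisChart

open CategoryTheory Opposite Function Field IntermediateField
open Literature.NumberTheory.GaloisRepresentations
open PadicKummer PadicKummer.Def22Context

universe v₁ u₁ v₂ u₂

section General

variable {D₁ : Type u₁} [Category.{v₁} D₁] {D₂ : Type u₂} [Category.{v₂} D₂] {p₁ p₂ : ℕ} [Fact p₁.Prime]
  [Fact p₂.Prime] {d₁ : Datum D₁ p₁} {d₂ : Datum D₂ p₂} {A₁ : d₁.frobenioid}
  {K₁ K₂ : Type} [Field K₁] [Field K₂] {L₁ : IntermediateField K₁ (AlgebraicClosure K₁)}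
  {L₂ : IntermediateField K₂ (AlgebraicClosure K₂)}
  (F : d₁.frobenioid ⥤ d₂.frobenioid) [F.Full] [F.Faithful]
  (c₁ : d₁.GaloisChart A₁ K₁ L₁) (c₂ : d₂.GaloisChart (F.obj A₁) K₂ L₂)
  (hO : ∀ f : A₁ ⟶ A₁, f ∈ PreFrobenioid.endSubmonoid d₁.structureFunctor A₁ ↔
    F.map f ∈ PreFrobenioid.endSubmonoid d₂.structureFunctor (F.obj A₁))
  (hker₁ : ∀ α : Aut A₁, c₁.res α = 1 ↔ α.hom ∈ PreFrobenioid.endSubmonoid d₁.structureFunctor A₁)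
  (hker₂ : ∀ β : Aut (F.obj A₁), c₂.res β = 1 ↔ β.hom ∈ PreFrobenioid.endSubmonoid d₂.structureFunctor (F.obj A₁))

/-- **`Aut_{C₁}(A₁) ⥲ Aut_{C₂}(Ψ A₁)`** induced by the fully faithful `Ψ` (`F.mapIso` / `F.preimageIso`).
[cite: MochizukiFrdII2008, Thm 2.4 (i) p.19] -/
def autEquiv : Aut A₁ ≃* Aut (F.obj A₁) where
  toFun α := F.mapIso α
  invFun β := F.preimageIso β
  left_inv α := F.preimageIso_mapIso α
  right_inv β := Iso.ext (F.map_preimage β.hom)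
  map_mul' x y := by
    change F.mapIso (y ≪≫ x) = F.mapIso y ≪≫ F.mapIso x
    exact F.mapIso_trans y x

/-- Unfolding `autEquiv`. [cite: MochizukiFrdII2008, Thm 2.4 (i) p.19] -/
@[simp] theorem autEquiv_apply (α : Aut A₁) : autEquiv F α = F.mapIso α := rfl

include hO hker₁ hker₂ in
/-- `Ψ` respects "same image in `Aut_E(A_E)`": if `res₁ α = res₁ α'` then `res₂ (Ψ α) = res₂ (Ψ α')`
(`α⁻¹α' ∈ O^×(A₁)`, preserved by `Ψ`). [cite: MochizukiFrdII2008, Thm 2.4 (i) p.19] -/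
theorem res_autEquiv_eq_of_res_eq {α α' : Aut A₁} (h : c₁.res α = c₁.res α') :
    c₂.res (autEquiv F α) = c₂.res (autEquiv F α') := by
  have h1 : c₁.res (α⁻¹ * α') = 1 := by rw [map_mul, map_inv, h, inv_mul_cancel]
  have h2 : (autEquiv F (α⁻¹ * α')).hom ∈ PreFrobenioid.endSubmonoid d₂.structureFunctor (F.obj A₁) :=
    (hO _).mp ((hker₁ _).mp h1)
  have h3 : c₂.res (autEquiv F (α⁻¹ * α')) = 1 := (hker₂ _).mpr h2
  rw [map_mul, map_inv, map_mul, map_inv, inv_mul_eq_one] at h3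
  exact h3

include hO hker₁ hker₂ in
/-- Conversely: if `res₂ (Ψ α) = res₂ (Ψ α')` then `res₁ α = res₁ α'`. [cite: MochizukiFrdII2008, Thm 2.4 (i) p.19] -/
theorem res_eq_of_res_autEquiv_eq {α α' : Aut A₁} (h : c₂.res (autEquiv F α) = c₂.res (autEquiv F α')) :
    c₁.res α = c₁.res α' := by
  have h3 : c₂.res (autEquiv F (α⁻¹ * α')) = 1 := by rw [map_mul, map_inv, map_mul, map_inv, h, inv_mul_cancel]
  have h2 : (α⁻¹ * α').hom ∈ PreFrobenioid.endSubmonoid d₁.structureFunctor A₁ :=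
    (hO _).mpr ((hker₂ _).mp h3)
  have h1 : c₁.res (α⁻¹ * α') = 1 := (hker₁ _).mpr h2
  rw [map_mul, map_inv, inv_mul_eq_one] at h1
  exact h1

/-- **`Aut_{E₁}((A₁)_{E₁}) ⥲ Aut_{E₂}((A₂)_{E₂})` = `Gal(L₁/K₁) ⥲ Gal(L₂/K₂)` induced by `Ψ`**:
`τ ↦ res₂ (Ψ α)` for any
lift `α` of `τ` (well defined by `res_autEquiv_eq_of_res_eq`). [cite: MochizukiFrdII2008, Thm 2.4 (i) p.19] -/
def galEquiv : (L₁ ≃ₐ[K₁] L₁) ≃* (L₂ ≃ₐ[K₂] L₂) where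
  toFun τ := c₂.res (autEquiv F (c₁.lift τ))
  invFun τ₂ := c₁.res ((autEquiv F).symm (c₂.lift τ₂))
  left_inv τ := by
    change c₁.res ((autEquiv F).symm (c₂.lift (c₂.res (autEquiv F (c₁.lift τ))))) = τ
    have h : c₂.res (autEquiv F ((autEquiv F).symm (c₂.lift (c₂.res (autEquiv F (c₁.lift τ)))))) =
        c₂.res (autEquiv F (c₁.lift τ)) := by
      rw [MulEquiv.apply_symm_apply, c₂.res_lift]
    rw [res_eq_of_res_autEquiv_eq F c₁ c₂ hO hker₁ hker₂ h, c₁.res_lift]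
  right_inv τ₂ := by
    change c₂.res (autEquiv F (c₁.lift (c₁.res ((autEquiv F).symm (c₂.lift τ₂))))) = τ₂
    rw [res_autEquiv_eq_of_res_eq F c₁ c₂ hO hker₁ hker₂ (c₁.res_lift _), MulEquiv.apply_symm_apply, c₂.res_lift]
  map_mul' τ σ := by
    rw [← map_mul, ← map_mul]
    exact res_autEquiv_eq_of_res_eq F c₁ c₂ hO hker₁ hker₂ (by rw [c₁.res_lift, map_mul, c₁.res_lift, c₁.res_lift])

/-- Unfolding `galEquiv`. [cite: MochizukiFrdII2008, Thm 2.4 (i) p.19] -/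
theorem galEquiv_apply (τ : L₁ ≃ₐ[K₁] L₁) :
    galEquiv F c₁ c₂ hO hker₁ hker₂ τ = c₂.res (autEquiv F (c₁.lift τ)) := rfl

/-- **`res₂ (Ψ α) = galEquiv (res₁ α)`** — the field `res_isoC` of the context isomorphism.
[cite: MochizukiFrdII2008, Thm 2.4 (i) p.19] -/
theorem galEquiv_res (α : Aut A₁) : galEquiv F c₁ c₂ hO hker₁ hker₂ (c₁.res α) = c₂.res (autEquiv F α) :=
  res_autEquiv_eq_of_res_eq F c₁ c₂ hO hker₁ hker₂ (c₁.res_lift _)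

/-- **`O^▷(A₁) ⥲ O^▷(Ψ A₁)`**, `f ↦ Ψ f` ("`Ψ` preserves `O^⊳(−)`", hO).
[cite: MochizukiFrdII2008, Thm 2.4 (i) p.20] -/
def objMonoidEquiv : ObjMonoid d₁ A₁ ≃* ObjMonoid d₂ (F.obj A₁) where
  toFun f := ObjMonoid.mk (F.map f.hom) ((hO _).mp f.hom_mem)
  invFun g := ObjMonoid.mk (F.preimage g.hom) ((hO _).mpr (by rw [F.map_preimage]; exact g.hom_mem))
  left_inv f := ObjMonoid.ext (by
    change F.preimage (F.map f.hom) = f.hom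
    exact F.preimage_map f.hom)
  right_inv g := ObjMonoid.ext (by
    change F.map (F.preimage g.hom) = g.hom
    exact F.map_preimage g.hom)
  map_mul' f g := ObjMonoid.ext (by
    change F.map (g.hom ≫ f.hom) = F.map g.hom ≫ F.map f.hom
    exact F.map_comp _ _)

/-- Unfolding `objMonoidEquiv`. [cite: MochizukiFrdII2008, Thm 2.4 (i) p.20] -/
@[simp] theorem hom_objMonoidEquiv (f : ObjMonoid d₁ A₁) : (objMonoidEquiv F hO f).hom = F.map f.hom := rfl

/-- `Ψ` intertwines the conjugation actions: `Ψ (α • f) = Ψ α • Ψ f`. [cite: MochizukiFrdII2008, Thm 2.4 (i) p.20] -/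
theorem objMonoidEquiv_smul_aut (α : Aut A₁) (f : ObjMonoid d₁ A₁) :
    objMonoidEquiv F hO (α • f) = autEquiv F α • objMonoidEquiv F hO f :=
  ObjMonoid.ext (by
    rw [hom_objMonoidEquiv, ObjMonoid.hom_smul, ObjMonoid.hom_smul, hom_objMonoidEquiv, F.map_comp, F.map_comp]
    rfl)

/-- **Equivariance along `galEquiv`** (the field `isoO_smul` of the context isomorphism): for the descended
actions (`galAction`), `Ψ (τ • f) = galEquiv τ • Ψ f`. [cite: MochizukiFrdII2008, Thm 2.4 (i) p.20] -/
theorem objMonoidEquiv_smul (τ : L₁ ≃ₐ[K₁] L₁) (f : ObjMonoid d₁ A₁) :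
    objMonoidEquiv F hO (letI := c₁.galAction; τ • f) =
      (letI := c₂.galAction; galEquiv F c₁ c₂ hO hker₁ hker₂ τ • objMonoidEquiv F hO f) := by
  rw [c₁.galAction_smul, c₂.galAction_smul, objMonoidEquiv_smul_aut]
  exact c₂.smul_eq_of_res_eq (by rw [c₂.res_lift, galEquiv_apply]) _

end General

/-! ### The context isomorphism (universe `0`) -/

section UniverseZero

variable {D₁ : Type} [SmallCategory D₁] {D₂ : Type} [SmallCategory D₂] {p₁ p₂ : ℕ} [Fact p₁.Prime]
  [Fact p₂.Prime] {d₁ : Datum D₁ p₁} {d₂ : Datum D₂ p₂} {A₁ : d₁.frobenioid}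
  {K₁ K₂ : Type} [Field K₁] [Field K₂] {L₁ : IntermediateField K₁ (AlgebraicClosure K₁)}
  {L₂ : IntermediateField K₂ (AlgebraicClosure K₂)} [Normal K₁ L₁] [FiniteDimensional K₁ L₁]
  [Normal K₂ L₂] [FiniteDimensional K₂ L₂]
  (F : d₁.frobenioid ⥤ d₂.frobenioid) [F.Full] [F.Faithful]
  (c₁ : d₁.GaloisChart A₁ K₁ L₁) (c₂ : d₂.GaloisChart (F.obj A₁) K₂ L₂)
  (hO : ∀ f : A₁ ⟶ A₁, f ∈ PreFrobenioid.endSubmonoid d₁.structureFunctor A₁ ↔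
    F.map f ∈ PreFrobenioid.endSubmonoid d₂.structureFunctor (F.obj A₁))
  (hker₁ : ∀ α : Aut A₁, c₁.res α = 1 ↔ α.hom ∈ PreFrobenioid.endSubmonoid d₁.structureFunctor A₁)
  (hker₂ : ∀ β : Aut (F.obj A₁), c₂.res β = 1 ↔ β.hom ∈ PreFrobenioid.endSubmonoid d₂.structureFunctor (F.obj A₁))
  (H₁ : Subgroup (absoluteGaloisGroup K₁)) [H₁.Normal] (hH₁ : IsOpen (H₁ : Set (absoluteGaloisGroup K₁)))
  (H₂ : Subgroup (absoluteGaloisGroup K₂)) [H₂.Normal] (hH₂ : IsOpen (H₂ : Set (absoluteGaloisGroup K₂)))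
  (isoG : absoluteGaloisGroup K₁ ≃ₜ* absoluteGaloisGroup K₂)
  (houter : ∀ g : absoluteGaloisGroup K₁, resGal L₂ (isoG g) = galEquiv F c₁ c₂ hO hker₁ hker₂ (resGal L₁ g))
  (map_H : H₁.map isoG.toMulEquiv.toMonoidHom = H₂) (hgal : IsGalois K₁ L₁ ↔ IsGalois K₂ L₂)

omit [FiniteDimensional K₁ L₁] [FiniteDimensional K₂ L₂] in
/-- The outer-isomorphism compatibility `houter` in its natural form: if `isoG` is compatible with `Ψ` on
automorphisms through the outer homomorphisms `G_{Kᵢ} ↠ Gal(Lᵢ/Kᵢ)` — "`Ψ_Base` lies over `G₁ ⥲ G₂`" — then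
`resGal L₂ ∘ isoG = galEquiv ∘ resGal L₁`. [cite: MochizukiFrdII2008, Thm 2.4 (i) p.19] -/
theorem houter_of_compat
    (h : ∀ (g : absoluteGaloisGroup K₁) (α : Aut A₁), c₁.res α = resGal L₁ g →
      c₂.res (autEquiv F α) = resGal L₂ (isoG g)) (g : absoluteGaloisGroup K₁) :
    resGal L₂ (isoG g) = galEquiv F c₁ c₂ hO hker₁ hker₂ (resGal L₁ g) := by
  rw [galEquiv_apply]
  exact (h g _ (c₁.res_lift _)).symm

/-- **The isomorphism of Definition 2.2 contexts induced by `Ψ`** (Thm. 2.4 (i): "`Ψ` … induces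
[`Aut_{C₁}(A₁) ⥲ Aut_{C₂}(A₂)`, `O^□(A₁) ⥲ O^□(A₂)`, `(G₁)_{A₁} ⥲ (G₂)_{A₂}`, …] over an outer isomorphism
`G₁ ⥲ G₂` mapping `H₁` onto `H₂`"), between the contexts `ofChart cᵢ Hᵢ …` of the objects `A₁`, `Ψ A₁`, from
the fully faithful `Ψ`, "`Ψ` preserves `O^⊳(−)`" (hO) and the outer isomorphism (isoG, houter, map_H).
[cite: MochizukiFrdII2008, Thm 2.4 (i) p.19] -/
def isoOfFunctor : (ofChart c₁ H₁ hH₁).Iso (ofChart c₂ H₂ hH₂) :=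
  letI := c₁.galAction; letI := c₂.galAction
  { isoC := autEquiv F
    isoO := objMonoidEquiv F hO
    isoE := galEquiv F c₁ c₂ hO hker₁ hker₂
    isoG := isoG
    res_isoC := fun α => (galEquiv_res F c₁ c₂ hO hker₁ hker₂ α).symm
    isoO_smul := fun τ f => objMonoidEquiv_smul F c₁ c₂ hO hker₁ hker₂ τ f
    outer_isoG := houter
    map_H := map_H
    isGalois_iff := hgal }

end UniverseZero

end GaloisChart

end Datum

end PadicFrd

end Literature.AlgebraicGeometry.Frobenioids

end
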